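import Summits.Schanuel.Schanuel.Theorems.ZilberEacLogTranscendence
import HarnessLib

/-!
# The equimodular class, XXXI: orders of vanishing for RECIPROCAL-TYPE quadratic fibres —
# the two polynomial identities that the logarithm of a branch would force are impossible

HONEST FRAMING.  Cell `pub-schanuel` (Zilber's Exponential-Algebraic Closedness, case ladder;
host summit Schanuel), seat 2, gen 24.  THEOREM EB (file XXIX) leaves the RECIPROCAL-TYPE quadratic
fibres `Q = q₂(x₀) y₀² + q₁(x₀) y₀ + c·q₂(x₀)` (product of the two branches constant).  For them the
logarithm `L = log(ρ/θ)` of a branch satisfies `L' = W S/(q₂ D)` with `S = 2q₂ρ + q₁`, `S² = D`,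
`D = q₁² - 4c q₂²`, `W = q₁ q₂' - q₂ q₁'`; if `L` were algebraic over `ℂ(z)` it would lie in
`ℂ(z) + ℂ(z)·S` (file XXXIII), `L = u + vS`, and then EITHER `S` itself would be rational
(`D·P₁² = P₂²`) OR `v = V₁/V₂` would solve `v' + vD'/(2D) = W/(q₂D)`, i.e.
`2q₂D(V₁'V₂ - V₁V₂') + q₂D'V₁V₂ = 2W V₂²`.  This file shows that BOTH polynomial identities are
impossible: **`sq_mul_ne_sq_of_simple_root`** (a simple root of `D` has odd multiplicity on the left,
even on the right) and **`reciprocal_ode_identity_ne`** (at a root `a` of `q₂` with `q₁(a) ≠ 0`: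
`ord_a` of the right side is `ord_a q₂ - 1 + 2 ord_a V₂`, of the left side it is `≥ ord_a q₂ + 2 ord_a V₂`
or `= ord_a q₂ + ord_a V₁ + ord_a V₂ - 1` with `ord_a V₁ ≠ ord_a V₂` — the Wronskian orders of gen 22
file II).  [folklore]; nothing here is specific to Schanuel's conjecture (neither used nor implied);
Mantova–Masser's question (PLMS 2024 §1 p. 5) and EC(3,2) stay OPEN.
-/

noncomputable section

open Polynomial

set_option linter.dupNamespace false

namespace Summit.Schanuel.Schanuel.Theorems

/-! ## Part A. `D·P₁² = P₂²` is impossible when `D` has a simple root -/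

/-- **A polynomial with a simple root is not a square times a square quotient**: `D P₁² ≠ P₂²` for
`P₁ ≠ 0` when `D(e) = 0 ≠ D'(e)`. [folklore] -/
theorem sq_mul_ne_sq_of_simple_root {D P₁ P₂ : ℂ[X]} {e : ℂ} (hDe : D.IsRoot e)
    (hD'e : ¬ (derivative D).IsRoot e) (hP₁ : P₁ ≠ 0) : D * P₁ ^ 2 ≠ P₂ ^ 2 := by
  have hD0 : D ≠ 0 := by
    intro h; rw [h, derivative_zero] at hD'e; exact hD'e (IsRoot.def.2 (eval_zero))
  have hmD : rootMultiplicity e D = 1 := by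
    have h1 : 1 ≤ rootMultiplicity e D := (rootMultiplicity_pos hD0).2 hDe
    have h2 := derivative_rootMultiplicity_of_root hDe
    have h3 : rootMultiplicity e (derivative D) = 0 := rootMultiplicity_eq_zero hD'e
    omega
  intro h
  have hL : rootMultiplicity e (D * P₁ ^ 2) = 1 + 2 * rootMultiplicity e P₁ := by
    rw [rootMultiplicity_mul (mul_ne_zero hD0 (pow_ne_zero _ hP₁)), hmD, pow_two,
      rootMultiplicity_mul (mul_ne_zero hP₁ hP₁)]
    ring
  have hP₂ : P₂ ≠ 0 := by
    intro h2; rw [h2, zero_pow two_ne_zero] at h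
    exact (mul_ne_zero hD0 (pow_ne_zero _ hP₁)) h
  have hR : rootMultiplicity e (P₂ ^ 2) = 2 * rootMultiplicity e P₂ := by
    rw [pow_two, rootMultiplicity_mul (mul_ne_zero hP₂ hP₂)]; ring
  have := congrArg (rootMultiplicity e) h
  rw [hL, hR] at this
  omega

/-! ## Part B. The ODE identity is impossible at a root of `q₂` that is not a root of `q₁` -/

/-- Root multiplicity of a polynomial that does not vanish at `a` times a power. [folklore] -/
theorem rootMultiplicity_mul_eq_of_not_root {F G : ℂ[X]} {a : ℂ} (hF : F ≠ 0) (hG : ¬ G.IsRoot a) :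
    rootMultiplicity a (F * G) = rootMultiplicity a F := by
  have hG0 : G ≠ 0 := fun h => hG (by rw [h]; exact IsRoot.def.2 eval_zero)
  rw [rootMultiplicity_mul (mul_ne_zero hF hG0), rootMultiplicity_eq_zero hG, add_zero]

/-- **The reciprocal ODE identity is impossible.**  `q₂ ≠ 0` with a root `a` that is not a root of
`q₁`, `V₂ ≠ 0`, `D = q₁² - 4c·q₂²`, `W = q₁q₂' - q₂q₁'`: then
`2 W V₂² ≠ q₂·(2D(V₁'V₂ - V₁V₂') + D'V₁V₂)` (orders of vanishing at `a`). [folklore] (new in this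
form) -/
theorem reciprocal_ode_identity_ne {q₁ q₂ V₁ V₂ : ℂ[X]} {a : ℂ} (c : ℂ) (hq₂ : q₂ ≠ 0)
    (ha : q₂.IsRoot a) (hq₁a : ¬ q₁.IsRoot a) (hV₂ : V₂ ≠ 0) :
    2 * (q₁ * derivative q₂ - q₂ * derivative q₁) * V₂ ^ 2 ≠
      q₂ * (2 * (q₁ ^ 2 - C (4 * c) * q₂ ^ 2) * (derivative V₁ * V₂ - V₁ * derivative V₂) +
        derivative (q₁ ^ 2 - C (4 * c) * q₂ ^ 2) * V₁ * V₂) := by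
  set D : ℂ[X] := q₁ ^ 2 - C (4 * c) * q₂ ^ 2 with hD
  set W : ℂ[X] := q₁ * derivative q₂ - q₂ * derivative q₁ with hW
  have hq₁ : q₁ ≠ 0 := fun h => hq₁a (by rw [h]; exact IsRoot.def.2 eval_zero)
  -- orders at `a`
  set m := rootMultiplicity a q₂ with hm
  have hm1 : 1 ≤ m := (rootMultiplicity_pos hq₂).2 ha
  have hDa : ¬ D.IsRoot a := by
    intro h
    rw [IsRoot, hD, eval_sub, eval_mul, eval_pow, eval_pow, eval_C, ha.eq_zero, zero_pow two_ne_zero,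
      mul_zero, sub_zero] at h
    exact hq₁a (pow_eq_zero_iff two_ne_zero |>.1 h)
  have hD0 : D ≠ 0 := fun h => hDa (by rw [h]; exact IsRoot.def.2 eval_zero)
  -- `W ≠ 0` with `ord_a W = m - 1`
  obtain ⟨-, hW0', hWord'⟩ := rootMultiplicity_logDeriv_num hq₂ hq₁ ha hq₁a
  have hWneg : W = -(q₂ * derivative q₁ - derivative q₂ * q₁) := by rw [hW]; ring
  have hW0 : W ≠ 0 := by rw [hWneg]; exact neg_ne_zero.2 hW0'
  have hWord : rootMultiplicity a W = m - 1 := by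
    rw [hWneg, rootMultiplicity_neg_eq, hWord', rootMultiplicity_mul_eq_of_not_root hq₂ hq₁a]
  -- the left side: nonzero of order `m - 1 + 2α`
  set α := rootMultiplicity a V₂ with hα
  have hL0 : 2 * W * V₂ ^ 2 ≠ 0 := mul_ne_zero (mul_ne_zero two_ne_zero hW0) (pow_ne_zero _ hV₂)
  have hLord : rootMultiplicity a (2 * W * V₂ ^ 2) = m - 1 + 2 * α := by
    rw [rootMultiplicity_mul hL0, rootMultiplicity_mul (mul_ne_zero two_ne_zero hW0),
      show (2 : ℂ[X]) = C 2 from (map_ofNat C 2).symm, rootMultiplicity_C, zero_add, hWord, pow_two,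
      rootMultiplicity_mul (mul_ne_zero hV₂ hV₂)]
    ring
  intro hEQ
  -- the right side is `q₂ · B`
  set B : ℂ[X] := 2 * D * (derivative V₁ * V₂ - V₁ * derivative V₂) + derivative D * V₁ * V₂ with hB
  have hEQ' : 2 * W * V₂ ^ 2 = q₂ * B := hEQ
  have hB0 : B ≠ 0 := by
    intro h; rw [h, mul_zero] at hEQ'; exact hL0 hEQ'
  have hRord : rootMultiplicity a (q₂ * B) = m + rootMultiplicity a B := by
    rw [rootMultiplicity_mul (mul_ne_zero hq₂ hB0)]
  have hordEQ : m - 1 + 2 * α = m + rootMultiplicity a B := by rw [← hLord, ← hRord, hEQ']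
  -- so `ord_a B = 2α - 1`; we show this is impossible
  by_cases hV₁ : V₁ = 0
  · apply hB0
    rw [hB, hV₁]
    simp
  set κ := rootMultiplicity a V₁ with hκ
  obtain ⟨P₁, hV₁P, hP₁⟩ := exists_eq_pow_rootMultiplicity_mul_and_not_dvd V₁ hV₁ a
  obtain ⟨Q₁, hV₂Q, hQ₁⟩ := exists_eq_pow_rootMultiplicity_mul_and_not_dvd V₂ hV₂ a
  rw [← hκ] at hV₁P
  rw [← hα] at hV₂Q
  -- the Wronskian part
  set Wr : ℂ[X] := derivative V₁ * V₂ - V₁ * derivative V₂ with hWr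
  have hWr' : Wr = -(V₁ * derivative V₂ - derivative V₁ * V₂) := by rw [hWr]; ring
  have hXW : (X - C a) * (V₁ * derivative V₂ - derivative V₁ * V₂) =
      (X - C a) ^ (α + κ) * ((((α : ℂ[X])) - ((κ : ℂ[X]))) * P₁ * Q₁ +
        (X - C a) * (P₁ * derivative Q₁ - derivative P₁ * Q₁)) := by
    conv_lhs => rw [hV₁P, hV₂Q]
    exact X_sub_C_mul_wronskian a α κ P₁ Q₁
  by_cases hκα : κ = α
  · -- equal orders: `(X - a)^{2α} ∣ Wr`, and `(X - a)^{2α} ∣ V₁ V₂`, so `(X - a)^{2α} ∣ B`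
    have hWrdvd : (X - C a) ^ (2 * α) ∣ Wr := by
      have h1 : (X - C a) * (V₁ * derivative V₂ - derivative V₁ * V₂) =
          (X - C a) * ((X - C a) ^ (2 * α) * (P₁ * derivative Q₁ - derivative P₁ * Q₁)) := by
        rw [hXW, hκα, sub_self, zero_mul, zero_mul, zero_add]; ring
      have h2 := mul_left_cancel₀ (X_sub_C_ne_zero a) h1
      rw [hWr', h2]
      exact (dvd_mul_right _ _).neg_right
    have hVVdvd : (X - C a) ^ (2 * α) ∣ V₁ * V₂ := by
      rw [hV₁P, hV₂Q, hκα, two_mul, pow_add]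
      exact mul_dvd_mul (dvd_mul_right _ _) (dvd_mul_right _ _)
    have hBdvd : (X - C a) ^ (2 * α) ∣ B := by
      rw [hB]
      refine dvd_add ?_ ?_
      · exact hWrdvd.mul_left _
      · rw [mul_assoc]; exact hVVdvd.mul_left _
    have hBord : 2 * α ≤ rootMultiplicity a B := (le_rootMultiplicity_iff hB0).2 hBdvd
    omega
  · -- different orders: `ord_a Wr = κ + α - 1`, `ord_a (D' V₁ V₂) ≥ κ + α`
    have hW₁a : ¬ (X - C a) ∣ ((((α : ℂ[X])) - ((κ : ℂ[X]))) * P₁ * Q₁ +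
        (X - C a) * (P₁ * derivative Q₁ - derivative P₁ * Q₁)) := by
      intro h
      have h' : (X - C a) ∣ (((α : ℂ[X])) - ((κ : ℂ[X]))) * P₁ * Q₁ := by
        have := dvd_sub h (dvd_mul_right (X - C a) (P₁ * derivative Q₁ - derivative P₁ * Q₁))
        simpa using this
      have hprime : Prime (X - C a) := prime_X_sub_C a
      rcases hprime.dvd_or_dvd h' with h'' | h''
      · rcases hprime.dvd_or_dvd h'' with h3 | h3
        · rw [dvd_iff_isRoot, IsRoot] at h3
          simp only [eval_sub, eval_natCast] at h3
          exact hκα (by exact_mod_cast (sub_eq_zero.1 h3).symm)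
        · exact hP₁ h3
      · exact hQ₁ h''
    have hWne : V₁ * derivative V₂ - derivative V₁ * V₂ ≠ 0 := by
      intro h0
      rw [h0, mul_zero] at hXW
      exact (mul_ne_zero (pow_ne_zero _ (X_sub_C_ne_zero a))
        fun h => hW₁a (by rw [h]; exact dvd_zero _)) hXW.symm
    have hκα1 : 1 ≤ κ + α := by rcases Nat.eq_zero_or_pos κ with h0 | h0 <;> omega
    have hrmW : rootMultiplicity a (V₁ * derivative V₂ - derivative V₁ * V₂) = α + κ - 1 := by
      have h1 : rootMultiplicity a ((X - C a) * (V₁ * derivative V₂ - derivative V₁ * V₂)) = α + κ := by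
        rw [hXW]; exact rootMultiplicity_pow_mul_of_not_dvd hW₁a
      rw [rootMultiplicity_mul (mul_ne_zero (X_sub_C_ne_zero a) hWne), rootMultiplicity_X_sub_C_self] at h1
      omega
    have hWr0 : Wr ≠ 0 := by rw [hWr']; exact neg_ne_zero.2 hWne
    have hrmWr : rootMultiplicity a Wr = α + κ - 1 := by rw [hWr', rootMultiplicity_neg_eq, hrmW]
    -- first term of `B`
    have hT1 : 2 * D * Wr ≠ 0 := mul_ne_zero (mul_ne_zero two_ne_zero hD0) hWr0
    have hT1ord : rootMultiplicity a (2 * D * Wr) = α + κ - 1 := by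
      rw [rootMultiplicity_mul hT1, rootMultiplicity_mul (mul_ne_zero two_ne_zero hD0),
        show (2 : ℂ[X]) = C 2 from (map_ofNat C 2).symm, rootMultiplicity_C, rootMultiplicity_eq_zero hDa,
        hrmWr]
      omega
    -- second term of `B` is divisible by `(X - a)^{α + κ}`
    have hT2dvd : (X - C a) ^ (α + κ - 1 + 1) ∣ derivative D * V₁ * V₂ := by
      rw [Nat.sub_add_cancel (by omega : 1 ≤ α + κ), mul_assoc, hV₁P, hV₂Q, add_comm, pow_add]
      exact (mul_dvd_mul (dvd_mul_right _ _) (dvd_mul_right _ _)).mul_left _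
    have hBord : rootMultiplicity a B = α + κ - 1 := by
      have hB' : B = derivative D * V₁ * V₂ + 2 * D * Wr := by rw [hB, hWr]; ring
      have hne := add_ne_zero_of_dvd_of_rootMultiplicity_eq (a := a) hT2dvd hT1 hT1ord
      rw [hB']
      apply le_antisymm
      · rw [rootMultiplicity_le_iff hne]
        intro h
        have h2 : (X - C a) ^ (α + κ - 1 + 1) ∣ 2 * D * Wr := by
          have := dvd_sub h hT2dvd
          rwa [add_sub_cancel_left] at this
        exact (rootMultiplicity_le_iff hT1 a _).1 hT1ord.le h2
      · rw [le_rootMultiplicity_iff hne]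
        refine dvd_add ((pow_dvd_pow _ (Nat.le_succ _)).trans hT2dvd) ?_
        rw [← hT1ord]; exact pow_rootMultiplicity_dvd _ _
    omega

end Summit.Schanuel.Schanuel.Theorems
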